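/-
Copyright (c) 2026. All rights reserved.
Released under Apache 2.0 license as described in the file LICENSE.
Authors: HodgeCM publication cell (pub-hodgecm), GR lane, third hand (`pub-hodgecm-own-crow`).
-/
import Literature.NumberTheory.Weil1964.AdelicMetaplecticGenerated
import Literature.NumberTheory.Weil1964.AdelicThetaWitness
import Literature.NumberTheory.Automorphic.AdelicPiSchwartzBruhatPlancherel
import HarnessLib

/-!
# Every LF-continuous adelic metaplectic operator is `L²`-isometric up to a positive scalar

Topic `NumberTheory/Weil1964`; namespace `Literature.NumberTheory.Weil1964`.  KERNEL ONLY: theorems, no definition,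
nothing of [Weil1964] asserted.

[Weil1964, Chap. I n° 13 p. 160] realises the metaplectic operators of the generators `d(α)`, `t(f)`, `d'(γ)` of the
symplectic group as explicit UNITARY operators of `L²(X)` preserving `𝒮(X)`; with the central scalars they give
everything ([MoeglinVignerasWaldspurger1987, Chap. 2 II.6]; the tree: `adelicMpCont.induction_on_generators`).  The
tree's metaplectic group of record `Mp_ψ(W_𝐀)ᶜᵒⁿᵗ = adelicMpCont F (Fin n) T` consists of pairs `(g, M)` with `M`
an LF-continuous automorphism of the SMOOTH model `𝒮(𝐀_Fⁿ) = piSchwartzBruhat F (Fin n)` determined by `g` up to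
`ℂˣ` (`AdelicMetaplecticKernel`), so `M` need not be `L²`-isometric.  This file proves, for an invertible Gram matrix
`T` and EVERY additive Haar measure `ν` on `𝐀_Fⁿ`:

* §1 the four generator families on underlying functions: `lintegral_enorm_sq_twist`
  (`∫⁻ ‖Φ(x g)‖ₑ² dν(x) = |det g|_𝐀⁻¹ ∫⁻ ‖Φ‖ₑ² dν`, the module of `x ↦ x g` — `AdelicRowVectorTwist.map_vecMul_eq_smul`),
  `lintegral_enorm_sq_chirp` (the second-degree characters are unimodular multipliers),
  `lintegral_enorm_sq_adelicPiFourier_neg` (**`∫⁻ ‖Φ̂(-x)‖ₑ² dν(x) = ∫⁻ ‖Φ‖ₑ² dν`** for the transform `Φ̂` of the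
  SELF-DUAL measure `ν₀` and ANY Haar `ν = a ν₀`: Plancherel `AdelicPiSchwartzBruhatPlancherel` + `ν₀(-·) = ν₀`);
* §2 **`adelicMpCont.exists_lintegral_enorm_sq_omega_eq_mul`**: for every `p ∈ Mp_ψ(W_𝐀)ᶜᵒⁿᵗ` there is a constant
  `c ∈ (0, ∞)` with `∫⁻ ‖ω(p)Φ‖ₑ² dν = c · ∫⁻ ‖Φ‖ₑ² dν` for ALL `Φ ∈ 𝒮(𝐀_Fⁿ)` — by induction on generators, the
  property being multiplicative (Levi pairs: `c = |det a|_𝐀`; unipotent pairs and the Weyl pair: `c = 1`; scalars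
  `(1, c·id)`: `|c|²`);
* §3 the constant is UNIQUE (`adelicMpCont.lintegral_enorm_sq_omega_scalar_unique`: `𝒮(𝐀_Fⁿ) ≠ 0` and a non-zero
  continuous `Φ` has `0 < ∫⁻ ‖Φ‖ₑ² < ∞`), hence MULTIPLICATIVE in `p` — so `p ↦ ω(p)/√c(p)` is a homomorphism to
  `L²(ν)`-isometric operators of `𝒮(𝐀_Fⁿ)`, the normalisation that kills exactly the positive scalars (kernel `S¹` of
  print's `Mp_𝐀(W)` versus `ℂˣ` of `Mp_ψ(W_𝐀)ᶜᵒⁿᵗ`).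

Use (GR lane of the Hodge/COR-CM cell, Track 2 of [GelbartRogawski1991, Prop. 3.1.1], ROADMAP (A2) "by generators"
— GR-1 `HANDOFF.g91` / GR-2 `AdelicMetaplecticGenerated`): with the density of `𝒮(𝐀_Fⁿ)` in `L²` and
`SchwartzBruhatL2UnitaryExtension`-style extension this is the map `Mp_ψ(W_𝐀)ᶜᵒⁿᵗ → U(L²(𝐀_Fⁿ))` onto unitary
implementers.  Nothing is cited as a hypothesis.

## References
* [Weil1964] A. Weil, Acta Math. 111 (1964) 143–211, Chap. I n° 11, n° 13 p. 160.
* [MoeglinVignerasWaldspurger1987] C. Mœglin, M.-F. Vignéras, J.-L. Waldspurger, LNM 1291 (1987), Chap. 2 II.1 (B), II.6.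
* [WeilBNT1967] A. Weil, *Basic Number Theory* (1967), Ch. IV §3, Cor. 1 of Prop. 3.
* [CasselsFrohlichANT1967] J. Tate, in Cassels–Fröhlich (eds.), *Algebraic Number Theory* (1967), Ch. XV, Thm. 4.1.2.
-/

set_option autoImplicit false

noncomputable section

open scoped Matrix ENNReal NNReal
open NumberField MeasureTheory MeasureTheory.Measure

namespace Literature.NumberTheory.Weil1964

open Literature.NumberTheory.Automorphic Literature.RepresentationTheory.HeisenbergGroup

variable (F : Type) [Field F] [NumberField F] {n : ℕ}
variable [MeasurableSpace (AdeleRing (𝓞 F) F)] [BorelSpace (AdeleRing (𝓞 F) F)]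
  (ν : Measure (Fin n → AdeleRing (𝓞 F) F)) [ν.IsAddHaarMeasure]

/-! ## §1 The generator families on underlying functions -/

section Generators

/-- **Levi operators**: `∫⁻ ‖Φ(x g)‖ₑ² dν(x) = |det g|_𝐀⁻¹ · ∫⁻ ‖Φ‖ₑ² dν` for `g ∈ GL_n(𝐀_F)` and every `Φ` — the
module of `x ↦ x g` on `𝐀_Fⁿ` is `|det g|_𝐀`. [cite: WeilBNT1967, Ch. IV §3 Cor. 1] -/
theorem lintegral_enorm_sq_twist (g : GL (Fin n) (AdeleRing (𝓞 F) F)) (Φ : (Fin n → AdeleRing (𝓞 F) F) → ℂ) :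
    ∫⁻ x, ‖twist F g Φ x‖ₑ ^ 2 ∂ν = ((adelicAbsDet n F g⁻¹ : ℝ≥0) : ℝ≥0∞) * ∫⁻ x, ‖Φ x‖ₑ ^ 2 ∂ν := by
  haveI := secondCountableTopology_adeleRing F
  haveI := locallyCompactSpace_adeleRing' F
  haveI := t2Space_adeleRing F
  haveI : BorelSpace (Fin n → AdeleRing (𝓞 F) F) := Pi.borelSpace
  have h := lintegral_map_equiv (μ := ν) (fun y => ‖Φ y‖ₑ ^ 2) (vecMulAddEquiv g).toHomeomorph.toMeasurableEquiv
  -- `h : ∫⁻ ‖Φ‖ₑ² d((x ↦ x g)_* ν) = ∫⁻ ‖Φ(x g)‖ₑ² dν`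
  refine (h.symm.trans ?_)
  change ∫⁻ y, ‖Φ y‖ₑ ^ 2 ∂(ν.map (vecMulAddEquiv g)) = _
  rw [map_vecMul_eq_smul, lintegral_smul_measure, smul_eq_mul]

omit [BorelSpace (AdeleRing (𝓞 F) F)] [ν.IsAddHaarMeasure] in
/-- **second-degree characters**: `∫⁻ ‖(chirp S Φ)(x)‖ₑ² dν = ∫⁻ ‖Φ‖ₑ² dν` — the multiplier `ψ(ᵗx S x)` is
unimodular. [cite: Weil1964, Chap. I n° 13 p. 160] -/
theorem lintegral_enorm_sq_chirp (S : Matrix (Fin n) (Fin n) (AdeleRing (𝓞 F) F))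
    (Φ : (Fin n → AdeleRing (𝓞 F) F) → ℂ) :
    ∫⁻ x, ‖chirp F S Φ x‖ₑ ^ 2 ∂ν = ∫⁻ x, ‖Φ x‖ₑ ^ 2 ∂ν := by
  refine lintegral_congr fun x => ?_
  rw [← ofReal_norm, ← ofReal_norm, norm_chirp_apply]

/-- **the Weyl operator `Φ ↦ Φ̂(-·)` is `L²(ν)`-isometric for EVERY Haar measure `ν`** when `Φ̂` is the transform for
the self-dual measure `ν₀` (`ν₀(Dⁿ) = 1`): `∫⁻ ‖Φ̂(-x)‖ₑ² dν(x) = ∫⁻ ‖Φ‖ₑ² dν` for `Φ ∈ 𝒮(𝐀_Fⁿ)` — Plancherel for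
`ν₀` (`lintegral_enorm_sq_adelicPiFourier_of_measure_eq_one`), `ν₀(-·) = ν₀`, and `ν = a · ν₀`.
[cite: CasselsFrohlichANT1967, Ch. XV (Tate), Thm. 4.1.2] [cite: Weil1964, Chap. I n° 13 p. 160] -/
theorem lintegral_enorm_sq_adelicPiFourier_neg (ν₀ : Measure (Fin n → AdeleRing (𝓞 F) F)) [ν₀.IsAddHaarMeasure]
    (hν₀ : ν₀ (piFundamentalDomain F (Fin n)) = 1) {Φ : (Fin n → AdeleRing (𝓞 F) F) → ℂ}
    (hΦ : Φ ∈ piSchwartzBruhat F (Fin n)) :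
    ∫⁻ x, ‖adelicPiFourier F (Fin n) ν₀ Φ (-x)‖ₑ ^ 2 ∂ν = ∫⁻ x, ‖Φ x‖ₑ ^ 2 ∂ν := by
  haveI := secondCountableTopology_adeleRing F
  haveI := locallyCompactSpace_adeleRing' F
  haveI := t2Space_adeleRing F
  haveI : BorelSpace (Fin n → AdeleRing (𝓞 F) F) := Pi.borelSpace
  -- `ν = a • ν₀`
  rw [isAddLeftInvariant_eq_smul ν ν₀, lintegral_smul_measure, lintegral_smul_measure]
  congr 1
  -- `ν₀` is invariant under `x ↦ -x`
  have hneg : ∫⁻ x, ‖adelicPiFourier F (Fin n) ν₀ Φ (-x)‖ₑ ^ 2 ∂ν₀ =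
      ∫⁻ x, ‖adelicPiFourier F (Fin n) ν₀ Φ x‖ₑ ^ 2 ∂ν₀ := by
    have h := lintegral_map_equiv (μ := ν₀) (fun y => ‖adelicPiFourier F (Fin n) ν₀ Φ y‖ₑ ^ 2)
      (MeasurableEquiv.neg (Fin n → AdeleRing (𝓞 F) F))
    refine h.symm.trans ?_
    change ∫⁻ y, ‖adelicPiFourier F (Fin n) ν₀ Φ y‖ₑ ^ 2 ∂(ν₀.map Neg.neg) = _
    rw [Measure.map_neg_eq_self]
  rw [hneg, lintegral_enorm_sq_adelicPiFourier_of_measure_eq_one ν₀ hΦ hν₀]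

end Generators

/-! ## §2 `Mp_ψ(W_𝐀)ᶜᵒⁿᵗ`: `L²`-isometry up to a positive scalar -/

section Metaplectic

variable (T : Matrix (Fin n) (Fin n) (AdeleRing (𝓞 F) F)) (hT : IsUnit T.det)

/-- arithmetic in `ℝ≥0∞`: `b = c a`, `c ∈ (0, ∞)` ⇒ `a = c⁻¹ b`. [folklore] -/
private theorem eq_inv_mul_of_eq_mul {a b c : ℝ≥0∞} (hc : c ≠ 0) (hc' : c ≠ ∞) (h : b = c * a) :
    a = c⁻¹ * b := by
  rw [h, ← mul_assoc, ENNReal.inv_mul_cancel hc hc', one_mul]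

/-- arithmetic in `ℝ≥0∞`: `b = c₁ m`, `m = c₂ a` ⇒ `b = (c₁ c₂) a`. [folklore] -/
private theorem eq_mul_mul_of_eq_mul {a b m c₁ c₂ : ℝ≥0∞} (h₁ : b = c₁ * m) (h₂ : m = c₂ * a) :
    b = c₁ * c₂ * a := by
  rw [h₁, h₂, mul_assoc]

omit [MeasurableSpace (AdeleRing (𝓞 F) F)] [BorelSpace (AdeleRing (𝓞 F) F)] in
/-- `ω(p q)Φ = ω(p)(ω(q)Φ)`. [cite: GelbartRogawski1991, §3.1 p. 454] -/
theorem adelicMpCont.omega_mul_apply (p q : adelicMpCont F (Fin n) T) (Φ : piSchwartzBruhat F (Fin n)) :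
    adelicMpCont.omega F (Fin n) T (p * q) Φ =
      adelicMpCont.omega F (Fin n) T p (adelicMpCont.omega F (Fin n) T q Φ) := by
  simpa only [Module.End.mul_apply] using
    LinearMap.congr_fun (map_mul (adelicMpCont.omega F (Fin n) T) p q) Φ

omit [MeasurableSpace (AdeleRing (𝓞 F) F)] [BorelSpace (AdeleRing (𝓞 F) F)] in
/-- `ω(p)(ω(p⁻¹)Φ) = Φ`. [cite: GelbartRogawski1991, §3.1 p. 454] -/
theorem adelicMpCont.omega_apply_omega_inv_apply (p : adelicMpCont F (Fin n) T) (Φ : piSchwartzBruhat F (Fin n)) :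
    adelicMpCont.omega F (Fin n) T p (adelicMpCont.omega F (Fin n) T p⁻¹ Φ) = Φ := by
  have hop : adelicMpCont.omega F (Fin n) T p * adelicMpCont.omega F (Fin n) T p⁻¹ = 1 := by
    rw [← map_mul, mul_inv_cancel, map_one]
  simpa only [Module.End.mul_apply, Module.End.one_apply] using LinearMap.congr_fun hop Φ

omit [MeasurableSpace (AdeleRing (𝓞 F) F)] [BorelSpace (AdeleRing (𝓞 F) F)] in
/-- `ω(1)Φ = Φ`. [cite: GelbartRogawski1991, §3.1 p. 454] -/
theorem adelicMpCont.omega_one_apply (Φ : piSchwartzBruhat F (Fin n)) :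
    adelicMpCont.omega F (Fin n) T 1 Φ = Φ := by
  simpa only [Module.End.one_apply] using LinearMap.congr_fun (map_one (adelicMpCont.omega F (Fin n) T)) Φ

omit [BorelSpace (AdeleRing (𝓞 F) F)] [ν.IsAddHaarMeasure] in
/-- `∫⁻ ‖(c f)(x)‖ₑ² dν = ‖c‖ₑ² ∫⁻ ‖f‖ₑ² dν`. [folklore] -/
private theorem lintegral_enorm_sq_const_smul (c : ℂ) (f : (Fin n → AdeleRing (𝓞 F) F) → ℂ) :
    ∫⁻ x, ‖(c • f) x‖ₑ ^ 2 ∂ν = ‖c‖ₑ ^ 2 * ∫⁻ x, ‖f x‖ₑ ^ 2 ∂ν := by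
  simp only [Pi.smul_apply, smul_eq_mul, enorm_mul, mul_pow]
  exact lintegral_const_mul' _ _ (ENNReal.pow_ne_top enorm_ne_top)

include hT in
/-- **EVERY LF-CONTINUOUS METAPLECTIC OPERATOR IS `L²`-ISOMETRIC UP TO A POSITIVE SCALAR**: for `p ∈ Mp_ψ(W_𝐀)ᶜᵒⁿᵗ`
(`T` invertible) and every additive Haar measure `ν` on `𝐀_Fⁿ` there is `c ∈ (0, ∞)` with
`∫⁻ ‖ω(p)Φ‖ₑ² dν = c · ∫⁻ ‖Φ‖ₑ² dν` for all `Φ ∈ 𝒮(𝐀_Fⁿ)`.  Proof: the property is stable under products and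
inverses and holds on the Levi pairs (`c = |det a|_𝐀`, §1), the unipotent pairs (`c = 1`), the Weyl pair of a
self-dual measure (`c = 1`, Plancherel) and the scalars (`|c|²`); conclude by `adelicMpCont.induction_on_generators`.
(The steps are chained with `congrArg` on the functional `Ψ ↦ ∫⁻ ‖Ψ‖ₑ² dν`: rewriting inside these operator terms is
expensive for the unifier.) [cite: Weil1964, Chap. I n° 13 p. 160] [cite: MoeglinVignerasWaldspurger1987, Chap. 2 II.6] -/
theorem adelicMpCont.exists_lintegral_enorm_sq_omega_eq_mul (p : adelicMpCont F (Fin n) T) :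
    ∃ c : ℝ≥0∞, c ≠ 0 ∧ c ≠ ∞ ∧ ∀ Φ : piSchwartzBruhat F (Fin n),
      ∫⁻ x, ‖((adelicMpCont.omega F (Fin n) T p Φ : piSchwartzBruhat F (Fin n)) :
          (Fin n → AdeleRing (𝓞 F) F) → ℂ) x‖ₑ ^ 2 ∂ν =
        c * ∫⁻ x, ‖(Φ : (Fin n → AdeleRing (𝓞 F) F) → ℂ) x‖ₑ ^ 2 ∂ν := by
  classical
  obtain ⟨ν₀, hν₀H, hν₀⟩ := exists_haar_measure_piFundamentalDomain_eq_one F (n := n)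
  haveI := hν₀H
  -- the `L²(ν)` functional, on `𝒮(𝐀_Fⁿ)` and on functions
  have tr : ∀ {Ψ₁ Ψ₂ : piSchwartzBruhat F (Fin n)}, Ψ₁ = Ψ₂ →
      ∫⁻ x, ‖(Ψ₁ : (Fin n → AdeleRing (𝓞 F) F) → ℂ) x‖ₑ ^ 2 ∂ν =
        ∫⁻ x, ‖(Ψ₂ : (Fin n → AdeleRing (𝓞 F) F) → ℂ) x‖ₑ ^ 2 ∂ν := fun e => e ▸ rfl
  have trf : ∀ {Ψ : piSchwartzBruhat F (Fin n)} {f : (Fin n → AdeleRing (𝓞 F) F) → ℂ},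
      ((Ψ : piSchwartzBruhat F (Fin n)) : (Fin n → AdeleRing (𝓞 F) F) → ℂ) = f →
      ∫⁻ x, ‖(Ψ : (Fin n → AdeleRing (𝓞 F) F) → ℂ) x‖ₑ ^ 2 ∂ν = ∫⁻ x, ‖f x‖ₑ ^ 2 ∂ν := fun e => e ▸ rfl
  refine adelicMpCont.induction_on_generators F T hT ν₀ hν₀
    (P := fun p => ∃ c : ℝ≥0∞, c ≠ 0 ∧ c ≠ ∞ ∧ ∀ Φ : piSchwartzBruhat F (Fin n),
      ∫⁻ x, ‖((adelicMpCont.omega F (Fin n) T p Φ : piSchwartzBruhat F (Fin n)) :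
          (Fin n → AdeleRing (𝓞 F) F) → ℂ) x‖ₑ ^ 2 ∂ν =
        c * ∫⁻ x, ‖(Φ : (Fin n → AdeleRing (𝓞 F) F) → ℂ) x‖ₑ ^ 2 ∂ν)
    ?_ ?_ ?_ ?_ ?_ ?_ ?_ p
  · -- `p = 1`
    refine ⟨1, one_ne_zero, ENNReal.one_ne_top, fun Φ => ?_⟩
    exact (tr (adelicMpCont.omega_one_apply F T Φ)).trans (one_mul _).symm
  · -- products
    rintro p q ⟨c₁, hc₁, hc₁', h₁⟩ ⟨c₂, hc₂, hc₂', h₂⟩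
    refine ⟨c₁ * c₂, mul_ne_zero hc₁ hc₂, ENNReal.mul_ne_top hc₁' hc₂', fun Φ => ?_⟩
    exact (tr (adelicMpCont.omega_mul_apply F T p q Φ)).trans
      (eq_mul_mul_of_eq_mul (h₁ (adelicMpCont.omega F (Fin n) T q Φ)) (h₂ Φ))
  · -- inverses
    rintro p ⟨c, hc, hc', h⟩
    refine ⟨c⁻¹, ENNReal.inv_ne_zero.2 hc', ENNReal.inv_ne_top.2 hc, fun Φ => ?_⟩
    exact eq_inv_mul_of_eq_mul hc hc'
      ((tr (adelicMpCont.omega_apply_omega_inv_apply F T p Φ)).symm.trans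
        (h (adelicMpCont.omega F (Fin n) T p⁻¹ Φ)))
  · -- Levi pairs: `Φ ↦ Φ ∘ a⁻¹ = twist (a⁻¹)ᵀ Φ`, constant `|det ((a⁻¹)ᵀ)⁻¹|_𝐀 = |det a|_𝐀`
    intro a
    refine ⟨((adelicAbsDet n F (trInv a)⁻¹ : ℝ≥0) : ℝ≥0∞), ?_, ENNReal.coe_ne_top, fun Φ => ?_⟩
    · have h : adelicAbsDet n F (trInv a)⁻¹ ≠ 0 := by
        rw [adelicAbsDet_apply]; exact ideleNorm_ne_zero _
      exact_mod_cast h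
    · exact (trf (coe_toOp_leviPair F T hT a Φ)).trans (lintegral_enorm_sq_twist F ν (trInv a) Φ)
  · -- unipotent pairs: unimodular chirps
    intro c hc
    refine ⟨1, one_ne_zero, ENNReal.one_ne_top, fun Φ => ?_⟩
    exact (trf (coe_toOp_unipPair F T hT c hc Φ)).trans
      ((lintegral_enorm_sq_chirp F ν _ Φ).trans (one_mul _).symm)
  · -- the Weyl pair of the self-dual measure `ν₀`: Plancherel
    refine ⟨1, one_ne_zero, ENNReal.one_ne_top, fun Φ => ?_⟩
    exact (trf (coe_fourierEquiv_symm hν₀ Φ)).trans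
      ((lintegral_enorm_sq_adelicPiFourier_neg F ν ν₀ hν₀ Φ.2).trans (one_mul _).symm)
  · -- scalars `(1, c·id)`
    intro c
    refine ⟨‖(c : ℂ)‖ₑ ^ 2, pow_ne_zero 2 (enorm_ne_zero.2 c.ne_zero), ENNReal.pow_ne_top enorm_ne_top,
      fun Φ => ?_⟩
    exact (tr (adelicMpCont.omega_ofScalar c Φ)).trans (lintegral_enorm_sq_const_smul F ν (c : ℂ) Φ)

/-! ## §3 Uniqueness and multiplicativity of the constant -/

/-- a non-zero Schwartz–Bruhat function has `0 < ∫⁻ ‖Φ‖ₑ² dν` (continuous, `ν` charges open sets).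
[cite: Weil1964, Chap. I n° 11] -/
theorem lintegral_enorm_sq_pos_of_mem_piSchwartzBruhat {Φ : (Fin n → AdeleRing (𝓞 F) F) → ℂ}
    (hΦ : Φ ∈ piSchwartzBruhat F (Fin n)) (hΦ0 : Φ ≠ 0) : 0 < ∫⁻ x, ‖Φ x‖ₑ ^ 2 ∂ν := by
  haveI := secondCountableTopology_adeleRing F
  haveI := locallyCompactSpace_adeleRing' F
  haveI := t2Space_adeleRing F
  haveI : BorelSpace (Fin n → AdeleRing (𝓞 F) F) := Pi.borelSpace
  have hc : Continuous Φ := continuous_of_mem_piSchwartzBruhat hΦ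
  obtain ⟨x₀, hx₀⟩ : ∃ x, Φ x ≠ 0 := by
    by_contra h
    push Not at h
    exact hΦ0 (funext h)
  have hsupp : (Function.support fun x => ‖Φ x‖ₑ ^ 2) = Function.support Φ := by
    ext x
    simp only [Function.mem_support, ne_eq, pow_eq_zero_iff two_ne_zero, enorm_eq_zero]
  have hmeas : Measurable fun x => ‖Φ x‖ₑ ^ 2 := (continuous_enorm.comp hc).measurable.pow_const 2
  have hpos := (lintegral_pos_iff_support hmeas (μ := ν)).2
    (by rw [hsupp]; exact hc.isOpen_support.measure_pos ν ⟨x₀, hx₀⟩)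
  exact hpos

/-- `𝒮(𝐀_Fⁿ)` has a vector with `0 < ∫⁻ ‖Φ‖ₑ² dν < ∞`. [cite: Weil1964, Chap. I n° 11] -/
theorem exists_lintegral_enorm_sq_pos_lt_top :
    ∃ Φ : piSchwartzBruhat F (Fin n), 0 < ∫⁻ x, ‖(Φ : (Fin n → AdeleRing (𝓞 F) F) → ℂ) x‖ₑ ^ 2 ∂ν ∧
      ∫⁻ x, ‖(Φ : (Fin n → AdeleRing (𝓞 F) F) → ℂ) x‖ₑ ^ 2 ∂ν < ∞ := by
  classical
  obtain ⟨Φ, hΦ, hΦ0⟩ := (Submodule.ne_bot_iff _).1 (piSchwartzBruhat_ne_bot F (Fin n))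
  exact ⟨⟨Φ, hΦ⟩, lintegral_enorm_sq_pos_of_mem_piSchwartzBruhat F ν hΦ hΦ0,
    lintegral_enorm_sq_lt_top_of_mem_piSchwartzBruhat ν hΦ⟩

/-- **the scalar is unique**: two constants `c, c'` with `∫⁻ ‖ω(p)Φ‖ₑ² dν = c ∫⁻ ‖Φ‖ₑ² dν = c' ∫⁻ ‖Φ‖ₑ² dν` for all
`Φ ∈ 𝒮(𝐀_Fⁿ)` coincide (test against a `Φ` with `0 < ‖Φ‖₂ < ∞`). [cite: Weil1964, Chap. I n° 13 p. 160] -/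
theorem adelicMpCont.lintegral_enorm_sq_omega_scalar_unique (p : adelicMpCont F (Fin n) T) {c c' : ℝ≥0∞}
    (hc : ∀ Φ : piSchwartzBruhat F (Fin n),
      ∫⁻ x, ‖((adelicMpCont.omega F (Fin n) T p Φ : piSchwartzBruhat F (Fin n)) :
          (Fin n → AdeleRing (𝓞 F) F) → ℂ) x‖ₑ ^ 2 ∂ν =
        c * ∫⁻ x, ‖(Φ : (Fin n → AdeleRing (𝓞 F) F) → ℂ) x‖ₑ ^ 2 ∂ν)
    (hc' : ∀ Φ : piSchwartzBruhat F (Fin n),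
      ∫⁻ x, ‖((adelicMpCont.omega F (Fin n) T p Φ : piSchwartzBruhat F (Fin n)) :
          (Fin n → AdeleRing (𝓞 F) F) → ℂ) x‖ₑ ^ 2 ∂ν =
        c' * ∫⁻ x, ‖(Φ : (Fin n → AdeleRing (𝓞 F) F) → ℂ) x‖ₑ ^ 2 ∂ν) :
    c = c' := by
  obtain ⟨Φ, h0, htop⟩ := exists_lintegral_enorm_sq_pos_lt_top F ν
  exact (ENNReal.mul_left_inj h0.ne' htop.ne).1 ((hc Φ).symm.trans (hc' Φ))

/-- **multiplicativity**: if `c_p, c_q` are constants for `p, q ∈ Mp_ψ(W_𝐀)ᶜᵒⁿᵗ` and `c_{pq}` one for `p q`, then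
`c_{pq} = c_p c_q` — the `L²`-norm ratio `λ(M)² = ‖MΦ‖₂²/‖Φ‖₂²` is a homomorphism `Mp_ψ(W_𝐀)ᶜᵒⁿᵗ → ℝ_{>0}`.
[cite: Weil1964, Chap. I n° 13 p. 160] [cite: MoeglinVignerasWaldspurger1987, Chap. 2 II.6] -/
theorem adelicMpCont.lintegral_enorm_sq_omega_scalar_mul (p q : adelicMpCont F (Fin n) T) {cp cq cpq : ℝ≥0∞}
    (hp : ∀ Φ : piSchwartzBruhat F (Fin n),
      ∫⁻ x, ‖((adelicMpCont.omega F (Fin n) T p Φ : piSchwartzBruhat F (Fin n)) :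
          (Fin n → AdeleRing (𝓞 F) F) → ℂ) x‖ₑ ^ 2 ∂ν =
        cp * ∫⁻ x, ‖(Φ : (Fin n → AdeleRing (𝓞 F) F) → ℂ) x‖ₑ ^ 2 ∂ν)
    (hq : ∀ Φ : piSchwartzBruhat F (Fin n),
      ∫⁻ x, ‖((adelicMpCont.omega F (Fin n) T q Φ : piSchwartzBruhat F (Fin n)) :
          (Fin n → AdeleRing (𝓞 F) F) → ℂ) x‖ₑ ^ 2 ∂ν =
        cq * ∫⁻ x, ‖(Φ : (Fin n → AdeleRing (𝓞 F) F) → ℂ) x‖ₑ ^ 2 ∂ν)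
    (hpq : ∀ Φ : piSchwartzBruhat F (Fin n),
      ∫⁻ x, ‖((adelicMpCont.omega F (Fin n) T (p * q) Φ : piSchwartzBruhat F (Fin n)) :
          (Fin n → AdeleRing (𝓞 F) F) → ℂ) x‖ₑ ^ 2 ∂ν =
        cpq * ∫⁻ x, ‖(Φ : (Fin n → AdeleRing (𝓞 F) F) → ℂ) x‖ₑ ^ 2 ∂ν) :
    cpq = cp * cq := by
  refine adelicMpCont.lintegral_enorm_sq_omega_scalar_unique F ν T (p * q) hpq fun Φ => ?_
  have tr : ∫⁻ x, ‖((adelicMpCont.omega F (Fin n) T (p * q) Φ : piSchwartzBruhat F (Fin n)) :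
          (Fin n → AdeleRing (𝓞 F) F) → ℂ) x‖ₑ ^ 2 ∂ν =
      ∫⁻ x, ‖((adelicMpCont.omega F (Fin n) T p (adelicMpCont.omega F (Fin n) T q Φ) : piSchwartzBruhat F (Fin n)) :
          (Fin n → AdeleRing (𝓞 F) F) → ℂ) x‖ₑ ^ 2 ∂ν :=
    adelicMpCont.omega_mul_apply F T p q Φ ▸ rfl
  exact tr.trans (eq_mul_mul_of_eq_mul (hp (adelicMpCont.omega F (Fin n) T q Φ)) (hq Φ))

end Metaplectic

end Literature.NumberTheory.Weil1964

end
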